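import Summits.CriticalPhenomena.PercolationContinuityZ3.Theorems.Transplant.SkelFrmBChoiceNums
import Summits.CriticalPhenomena.PercolationContinuityZ3.Theorems.Transplant.SkelFrmBParamsFaceBandA2
import HarnessLib

/-!
# N2 (frames-only node `SamePDropOfSkeletonFrm₁`, OPEN) params column over `PlanarSkeletonFrm` — (F) value layer, **J19 / R0 SUCCESSOR of
# `SkelFrmBParamsFaceBandA2`** (lead g12 2026-08-23T08:47:30Z: ONE kit radius in N2's (F) layer, the (S0) kit of record `KS0.R'0`/`KS0.Rlev0`/`KS0.reach0`
# (SkelFrmBChoiceNums); the apron kit `KitA`/`KS.RA'`/`KS.RlevA`/`KS.reachA` does not enter N2's (F) column; hp-8 g42's name table 08:54:57Z).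

RULE (hp-8's registry rule): this successor module IMPORTS the original (nothing radius-free lives there); the RA′-cone declarations `hkE_RA2` (`Rl ≤ 2RA′`),
`apronRl_le`, `hkE_apron_RA` are re-stated at the (S0) kit as **`hkE_R02`** (`Rl ≤ 2·R'0`), **`kit0Rl_le`** (`Rlev0 + reach0 − 1 ≤ 2·R'0`, from `KS0.R'0_eq`:
`R'0 = Rlev0 + 1`, `Rlev0 = j₁0 + reach0 ≥ reach0`) and **`hkE_kit0_R0`** (the band rooms at the keystone's `kE`-reach `Rl := Rlev0 + reach0 − 1`); and the two
NEW single-`kE` rows at **`4·r⊥`** asked by hp-8 g42 (08:46:54Z E6 / 08:54:57Z) for the creep-aware habitat rows of (R-40) (`kE + 8u + 8 + P.c i ≤ 5r⊥` with the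
per-axis cap `P.c i ≤ r⊥`): **`hkE8_R0₄ : kFF₂ + 8u + 8 ≤ 4·r⊥`** and **`hkE24_R0₄ : kFF₂ + 24u + 24 ≤ 4·r⊥`**, every `Rl ≤ 2·R'0` (room: `kFF₂ ≤ 2r + 10R'0 + 15`,
`10R'0 < 2u`, `2r ≥ 80u ≥ 26u + 39`). (The two-`kE` row `2kE + 24u + 24 + 2c ≤ 5r` of J21 is NOT a `4r⊥` fact — ruled (b) `Kmin`, lead g12 09:49:01Z, hp-8/stmt's pen.)
THE ONE NON-MECHANICAL STEP (device (d)): the stride floor travels as the NAMED HYPOTHESIS `huR0 : 6·R'0 + 11 ≤ u_J` (`u_J = if oth I = 0 then u₀A else u₁A`;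
shape of `TXAR0.hkE8_RAR0` p359097 / hp-8's POSTED FLOORS (4); `NegB.uA_oth_factsR0`/`huR0_of_box` serve it from the box floor `4·K·(R'0+2) ≤ M_L`).
builds on p205010 (kernel theorem, internal audit signed; external expert review pending) — nothing in this file uses p205010; NOTHING is
claimed about the open node `SamePDropOfSkeletonFrm₁`; arithmetic only. The RA′ originals stay in the tree as valid, unused history.
Lane `prim-bschramm-*`, seat `prim-bschramm-p1` (gen 18); helper file (`--supports stmt-CriticalPhenomena-4575 --as helper`).
[cite: KozmaNitzan2024, §4 Lemma 12 (pp. 23–25)] [cite: MartineauTassion2017, §4.1]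
-/

noncomputable section

open scoped Classical

namespace Summit.CriticalPhenomena.PercolationContinuityZ3.Theorems.Transplant

namespace PlanarSkeletonFrm

namespace NegB

open Literature.Probability.Percolation Literature.Probability.LatticeModels SimpleGraph
open Literature.Probability.Percolation.KozmaNitzan.Cells (oth)
open SkelConc (Consts)
open Skelφ.StepI (DataN)
open Neg

section Band2

/-- **THE CONTACT BAND ROOMS AT `Rl ≤ 2·R'0`** (`g := gT`, both axes, `u_JA = s_J`), under the stride floor `huR0 : 6·R'0 + 11 ≤ u_JA`:
`kFF₂ + 8·u_JA + 9 ≤ 5·r_J` and `2·kFF₂ + 8·u_JA + 8 ≤ 5·r_J` (from `kFF₂ ≤ 2r + 5Rl + 15`, `10·R'0 < 2·u_JA`, `40·u_JA ≤ r_J`) — the R′0 successor of `hkE_RA2`.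
[cite: KozmaNitzan2024, §4 Lemma 12 (pp. 23–25)] -/
theorem hkE_R02 (κ : Consts) {V : Type} [DecidableEq V] [Countable V] {G : SimpleGraph V} [G.LocallyFinite] (Φ : PlanarSkeletonFrm G) (t : V) (p : unitInterval) (D : Skelφ.StepI.DataNS V) (f : ℕ) (mk : ℕ) (gx : Neg.FSlot) (hN : EqNumL κ Φ t p D (KS.gT mk gx κ Φ t p D) f) (hκ : (hL κ Φ t p D (KS.gT mk gx κ Φ t p D) f).natAbs ≤ 10 * nL κ Φ t p D (KS.gT mk gx κ Φ t p D) f)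
    {Rl : ℕ} (hRl : Rl ≤ 2 * KS0.R'0 κ Φ t p D mk) (I : Fin 2)
    (huR0 : 6 * (KS0.R'0 κ Φ t p D mk : ℤ) + 11 ≤ (if oth I = 0 then KS.u₀A κ Φ t p D (KS.gT mk gx κ Φ t p D) f else KS.u₁A κ Φ t p D (KS.gT mk gx κ Φ t p D) f)) :
    (prFA κ Φ t p D (KS.gT mk gx κ Φ t p D) f).kFF₂ (fcellsA κ Φ t p D (KS.gT mk gx κ Φ t p D) f) Rl I +
          8 * (if oth I = 0 then KS.u₀A κ Φ t p D (KS.gT mk gx κ Φ t p D) f else KS.u₁A κ Φ t p D (KS.gT mk gx κ Φ t p D) f) + 9 ≤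
        5 * ((fcellsA κ Φ t p D (KS.gT mk gx κ Φ t p D) f).r (oth I) : ℤ) ∧
      2 * (prFA κ Φ t p D (KS.gT mk gx κ Φ t p D) f).kFF₂ (fcellsA κ Φ t p D (KS.gT mk gx κ Φ t p D) f) Rl I +
          8 * (if oth I = 0 then KS.u₀A κ Φ t p D (KS.gT mk gx κ Φ t p D) f else KS.u₁A κ Φ t p D (KS.gT mk gx κ Φ t p D) f) + 8 ≤
        5 * ((fcellsA κ Φ t p D (KS.gT mk gx κ Φ t p D) f).r (oth I) : ℤ) := by
  have hq := kFF₂_le_linA κ Φ t p D f mk gx hN hκ Rl I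
  obtain ⟨-, -, hru⟩ := uA_oth_facts κ Φ t p D f mk gx hN hκ I
  have hu := huR0
  have hRl' : (Rl : ℤ) ≤ 2 * KS0.R'0 κ Φ t p D mk := by exact_mod_cast hRl
  have hR0 : (0 : ℤ) ≤ (Rl : ℤ) := Nat.cast_nonneg _
  set q := (prFA κ Φ t p D (KS.gT mk gx κ Φ t p D) f).kFF₂ (fcellsA κ Φ t p D (KS.gT mk gx κ Φ t p D) f) Rl I
  set u := (if oth I = 0 then KS.u₀A κ Φ t p D (KS.gT mk gx κ Φ t p D) f else KS.u₁A κ Φ t p D (KS.gT mk gx κ Φ t p D) f)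
  set r := ((fcellsA κ Φ t p D (KS.gT mk gx κ Φ t p D) f).r (oth I) : ℤ)
  constructor <;> linarith

/-- **The (S0) kit's band reach is at most `2·R'0`**: `Rlev0 + reach0 − 1 ≤ 2·R'0` (`R'0 = Rlev0 + 1`, `Rlev0 = j₁0 + reach0 ≥ reach0`) — the R′0 successor of
`apronRl_le`. [folklore] -/
theorem kit0Rl_le (κ : Consts) {V : Type} [DecidableEq V] [Countable V] {G : SimpleGraph V} [G.LocallyFinite] (Φ : PlanarSkeletonFrm G) (t : V) (p : unitInterval) (D : Skelφ.StepI.DataNS V) (mk : ℕ) :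
    KS0.Rlev0 κ Φ t p D mk + KS0.reach0 t D mk - 1 ≤ 2 * KS0.R'0 κ Φ t p D mk := by
  have h := KS0.R'0_eq κ Φ t p D mk
  unfold KS0.Rlev0 at h ⊢
  omega

/-- **THE CONTACT BAND ROOMS AT THE KEYSTONE's `kE`-REACH** (`Rl := Rlev0 + reach0 − 1`, hp-8's `kE := kFF₂ … (E − 1) du.1`, `E := Rlev0 + reach0`), under `huR0`:
`kFF₂ + 8·u_JA + 9 ≤ 5·r_J` and `2·kFF₂ + 8·u_JA + 8 ≤ 5·r_J` — the R′0 successor of `hkE_apron_RA`. [cite: KozmaNitzan2024, §4 Lemma 12 (pp. 23–25)] -/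
theorem hkE_kit0_R0 (κ : Consts) {V : Type} [DecidableEq V] [Countable V] {G : SimpleGraph V} [G.LocallyFinite] (Φ : PlanarSkeletonFrm G) (t : V) (p : unitInterval) (D : Skelφ.StepI.DataNS V) (f : ℕ) (mk : ℕ) (gx : Neg.FSlot) (hN : EqNumL κ Φ t p D (KS.gT mk gx κ Φ t p D) f) (hκ : (hL κ Φ t p D (KS.gT mk gx κ Φ t p D) f).natAbs ≤ 10 * nL κ Φ t p D (KS.gT mk gx κ Φ t p D) f)
    (I : Fin 2)
    (huR0 : 6 * (KS0.R'0 κ Φ t p D mk : ℤ) + 11 ≤ (if oth I = 0 then KS.u₀A κ Φ t p D (KS.gT mk gx κ Φ t p D) f else KS.u₁A κ Φ t p D (KS.gT mk gx κ Φ t p D) f)) :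
    (prFA κ Φ t p D (KS.gT mk gx κ Φ t p D) f).kFF₂ (fcellsA κ Φ t p D (KS.gT mk gx κ Φ t p D) f) (KS0.Rlev0 κ Φ t p D mk + KS0.reach0 t D mk - 1) I +
          8 * (if oth I = 0 then KS.u₀A κ Φ t p D (KS.gT mk gx κ Φ t p D) f else KS.u₁A κ Φ t p D (KS.gT mk gx κ Φ t p D) f) + 9 ≤
        5 * ((fcellsA κ Φ t p D (KS.gT mk gx κ Φ t p D) f).r (oth I) : ℤ) ∧
      2 * (prFA κ Φ t p D (KS.gT mk gx κ Φ t p D) f).kFF₂ (fcellsA κ Φ t p D (KS.gT mk gx κ Φ t p D) f) (KS0.Rlev0 κ Φ t p D mk + KS0.reach0 t D mk - 1) I +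
          8 * (if oth I = 0 then KS.u₀A κ Φ t p D (KS.gT mk gx κ Φ t p D) f else KS.u₁A κ Φ t p D (KS.gT mk gx κ Φ t p D) f) + 8 ≤
        5 * ((fcellsA κ Φ t p D (KS.gT mk gx κ Φ t p D) f).r (oth I) : ℤ) :=
  hkE_R02 κ Φ t p D f mk gx hN hκ (kit0Rl_le κ Φ t p D mk) I huR0

/-! ### The `4·r⊥` rows for the creep-aware habitat of (R-40) (hp-8 g42 08:54:57Z) -/

/-- **`kFF₂ + 8·u + 8 ≤ 4·r_(oth I)` for every `Rl ≤ 2·R'0`**, under `huR0` — serves hp-8's creep-aware row `kE + 8u + 8 + P.c i ≤ 5·r⊥` with the per-axis cap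
`P.c i ≤ r⊥` (room: `kFF₂ ≤ 2r + 10R'0 + 15`, `10R'0 < 2u`, `2r ≥ 80u`). [cite: KozmaNitzan2024, §4 Lemma 12 (pp. 23–25)] -/
theorem hkE8_R0₄ (κ : Consts) {V : Type} [DecidableEq V] [Countable V] {G : SimpleGraph V} [G.LocallyFinite] (Φ : PlanarSkeletonFrm G) (t : V) (p : unitInterval) (D : Skelφ.StepI.DataNS V) (f : ℕ) (mk : ℕ) (gx : Neg.FSlot) (hN : EqNumL κ Φ t p D (KS.gT mk gx κ Φ t p D) f) (hκ : (hL κ Φ t p D (KS.gT mk gx κ Φ t p D) f).natAbs ≤ 10 * nL κ Φ t p D (KS.gT mk gx κ Φ t p D) f)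
    {Rl : ℕ} (hRl : Rl ≤ 2 * KS0.R'0 κ Φ t p D mk) (I : Fin 2)
    (huR0 : 6 * (KS0.R'0 κ Φ t p D mk : ℤ) + 11 ≤ (if oth I = 0 then KS.u₀A κ Φ t p D (KS.gT mk gx κ Φ t p D) f else KS.u₁A κ Φ t p D (KS.gT mk gx κ Φ t p D) f)) :
    (prFA κ Φ t p D (KS.gT mk gx κ Φ t p D) f).kFF₂ (fcellsA κ Φ t p D (KS.gT mk gx κ Φ t p D) f) Rl I +
        8 * (if oth I = 0 then KS.u₀A κ Φ t p D (KS.gT mk gx κ Φ t p D) f else KS.u₁A κ Φ t p D (KS.gT mk gx κ Φ t p D) f) + 8 ≤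
      4 * ((fcellsA κ Φ t p D (KS.gT mk gx κ Φ t p D) f).r (oth I) : ℤ) := by
  have hq := kFF₂_le_linA κ Φ t p D f mk gx hN hκ Rl I
  obtain ⟨-, -, hru⟩ := uA_oth_facts κ Φ t p D f mk gx hN hκ I
  have hu := huR0
  have hRl' : (Rl : ℤ) ≤ 2 * KS0.R'0 κ Φ t p D mk := by exact_mod_cast hRl
  have hR0 : (0 : ℤ) ≤ (Rl : ℤ) := Nat.cast_nonneg _
  have hR : (0 : ℤ) ≤ (KS0.R'0 κ Φ t p D mk : ℤ) := Nat.cast_nonneg _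
  set q := (prFA κ Φ t p D (KS.gT mk gx κ Φ t p D) f).kFF₂ (fcellsA κ Φ t p D (KS.gT mk gx κ Φ t p D) f) Rl I
  set u := (if oth I = 0 then KS.u₀A κ Φ t p D (KS.gT mk gx κ Φ t p D) f else KS.u₁A κ Φ t p D (KS.gT mk gx κ Φ t p D) f)
  set r := ((fcellsA κ Φ t p D (KS.gT mk gx κ Φ t p D) f).r (oth I) : ℤ)
  linarith

/-- **`kFF₂ + 24·u + 24 ≤ 4·r_(oth I)` for every `Rl ≤ 2·R'0`**, under `huR0` — the `24u` twin (tangential rows) for the creep-aware habitat with `P.c i ≤ r⊥`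
(room: `2r ≥ 80u ≥ 26u + 39`). [cite: KozmaNitzan2024, §4 Lemma 12 (pp. 23–25)] -/
theorem hkE24_R0₄ (κ : Consts) {V : Type} [DecidableEq V] [Countable V] {G : SimpleGraph V} [G.LocallyFinite] (Φ : PlanarSkeletonFrm G) (t : V) (p : unitInterval) (D : Skelφ.StepI.DataNS V) (f : ℕ) (mk : ℕ) (gx : Neg.FSlot) (hN : EqNumL κ Φ t p D (KS.gT mk gx κ Φ t p D) f) (hκ : (hL κ Φ t p D (KS.gT mk gx κ Φ t p D) f).natAbs ≤ 10 * nL κ Φ t p D (KS.gT mk gx κ Φ t p D) f)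
    {Rl : ℕ} (hRl : Rl ≤ 2 * KS0.R'0 κ Φ t p D mk) (I : Fin 2)
    (huR0 : 6 * (KS0.R'0 κ Φ t p D mk : ℤ) + 11 ≤ (if oth I = 0 then KS.u₀A κ Φ t p D (KS.gT mk gx κ Φ t p D) f else KS.u₁A κ Φ t p D (KS.gT mk gx κ Φ t p D) f)) :
    (prFA κ Φ t p D (KS.gT mk gx κ Φ t p D) f).kFF₂ (fcellsA κ Φ t p D (KS.gT mk gx κ Φ t p D) f) Rl I +
        24 * (if oth I = 0 then KS.u₀A κ Φ t p D (KS.gT mk gx κ Φ t p D) f else KS.u₁A κ Φ t p D (KS.gT mk gx κ Φ t p D) f) + 24 ≤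
      4 * ((fcellsA κ Φ t p D (KS.gT mk gx κ Φ t p D) f).r (oth I) : ℤ) := by
  have hq := kFF₂_le_linA κ Φ t p D f mk gx hN hκ Rl I
  obtain ⟨-, -, hru⟩ := uA_oth_facts κ Φ t p D f mk gx hN hκ I
  have hu := huR0
  have hRl' : (Rl : ℤ) ≤ 2 * KS0.R'0 κ Φ t p D mk := by exact_mod_cast hRl
  have hR0 : (0 : ℤ) ≤ (Rl : ℤ) := Nat.cast_nonneg _
  have hR : (0 : ℤ) ≤ (KS0.R'0 κ Φ t p D mk : ℤ) := Nat.cast_nonneg _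
  set q := (prFA κ Φ t p D (KS.gT mk gx κ Φ t p D) f).kFF₂ (fcellsA κ Φ t p D (KS.gT mk gx κ Φ t p D) f) Rl I
  set u := (if oth I = 0 then KS.u₀A κ Φ t p D (KS.gT mk gx κ Φ t p D) f else KS.u₁A κ Φ t p D (KS.gT mk gx κ Φ t p D) f)
  set r := ((fcellsA κ Φ t p D (KS.gT mk gx κ Φ t p D) f).r (oth I) : ℤ)
  linarith

end Band2

end NegB

end PlanarSkeletonFrm

end Summit.CriticalPhenomena.PercolationContinuityZ3.Theorems.Transplant

end
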